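import Summits.NavierStokesRegularity.NavierStokesRegularity.Theorems.EfficiencyFloorProductionEfficiencyDecayScalarBarrier
import HarnessLib

/-!
# Shelf crux `EnstrophyQuarterLaw` (stmt-NavierStokesRegularity-1574): the quarter law is not reachable from the scalar
# enstrophy budget — an explicit budget triple in the ENERGY CLASS obeying the POINTWISE efficiency law of the sibling
# crux stmt-22866 and still violating Leray's rate

Helper file (`--supports stmt-NavierStokesRegularity-1574`; Mathlib-only apart from the sibling barrier
`…ProductionEfficiencyDecayScalarBarrier` (p830537), route-independent, def-free). Mirror statement, for the RESIDUAL jaw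
of the enstrophy pincer, of the scalar barrier landed for the attacked jaw: for EVERY envelope constant `c > 0` and
viscosity `ν > 0` the explicit triple on `[0,1)`

  `Z = μ²·ℓ/√(1−t)`, `Pal = μ²·(ℓ/√(1−t))³`, `S = (Ż + 2ν·Pal)/2`, `ℓ = 1 − log(1−t)`, `μ = (3/4 + ν)/c`,

satisfies every scalar clause of the registered budget stubs (`0 < Z`, `0 ≤ Pal`, `HasDerivAt Z (2S − 2ν·Pal)`,
`|S| ≤ c·Z^{3/4}·Pal^{3/4}`), blow-up `Z → ∞`, the ENERGY CLASS `∫₀ˢ Z ≤ 6μ²`, the palinstrophy-ratio budget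
`∫₀ˢ Pal/Z² ≤ 6/μ²`, AND the POINTWISE efficiency law of crux stmt-22866 (`Ż ≤ εZ³` eventually, for every `ε > 0`:
here `Ż/Z³ = (1 + ℓ/2)/(μ⁴ℓ³) → 0`) — and yet NOT the quarter law: `Z√(1−t) = μ²ℓ → ∞`
(`scalarBarrier_quarterLaw`). So at the level of scalar functional inequalities among `Z, Pal, S` (cubic law, energy
class, ratio budget) the two jaws `ProductionEfficiencyDecay` (22866) and `EnstrophyQuarterLaw` (1574) are INDEPENDENT:
the sibling file has a triple with the mean law but neither jaw's pointwise content, this file one with the attacked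
jaw and without the residual. Any proof of stmt-1574 — even granted stmt-22866 — needs non-scalar (spatial) input, as its
registered line «sparse_sieve» (uniform local Type I, uniform sparseness, 0056) indeed posits.

HONEST FRAMING: a statement about explicit real functions; nothing about Navier–Stokes is asserted; stmt-1574, stmt-22866
and NS regularity stay OPEN; no registered stub is closed. [folklore]
-/

-- the problem directory repeats the summit name (`NavierStokesRegularity/NavierStokesRegularity`)
set_option linter.dupNamespace false

noncomputable section

namespace Summit.NavierStokesRegularity.NavierStokesRegularity.Theorems

namespace EnstrophyQuarterLaw

namespace ScalarBarrier

open Set Filter Topology Real MeasureTheory intervalIntegral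
open ProductionEfficiencyDecay.ScalarBarrier (basic hasDerivAt_ell hasDerivAt_prim continuousOn_model rpow_budget)

/-- Derivative of the monotone model `z₀(t) = ℓ/√(1−t)`, `ℓ = 1 − log(1−t)`, for `t < 1`: `ż₀ = (1 + ℓ/2)/(√(1−t))³`.
[folklore] -/
theorem hasDerivAt_model₀ {t : ℝ} (ht : t < 1) :
    HasDerivAt (fun s : ℝ => (1 - Real.log (1 - s)) / Real.sqrt (1 - s)) ((1 + (1 - Real.log (1 - t)) / 2) / Real.sqrt (1 - t) ^ 3) t := by
  have hpos : 0 < 1 - t := sub_pos.2 ht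
  have h1 : HasDerivAt (fun s : ℝ => 1 - s) (-1) t := by
    simpa using (hasDerivAt_id t).const_sub 1
  have hw : HasDerivAt (fun s : ℝ => Real.sqrt (1 - s)) ((-1) / (2 * Real.sqrt (1 - t))) t :=
    h1.sqrt hpos.ne'
  have hwne : Real.sqrt (1 - t) ≠ 0 := (Real.sqrt_pos.2 hpos).ne'
  refine ((hasDerivAt_ell ht).div hw hwne).congr_deriv ?_
  set w : ℝ := Real.sqrt (1 - t) with hw_def
  have hw2 : w ^ 2 = 1 - t := by rw [hw_def]; exact Real.sq_sqrt hpos.le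
  have hwpos : 0 < w := Real.sqrt_pos.2 hpos
  rw [← hw2]
  field_simp
  ring

/-- `∫₀ˢ ℓ/√(1−t) dt ≤ 6` for `s ∈ [0,1)` (`= 6 − 2√(1−s)(3 − log(1−s))`, by the sibling file's antiderivative).
[folklore] -/
theorem integral_model₀_le {s : ℝ} (hs : s ∈ Ico (0 : ℝ) 1) :
    ∫ t in (0 : ℝ)..s, ((1 - Real.log (1 - t)) / Real.sqrt (1 - t)) ≤ 6 := by
  have hcq := (continuousOn_model hs.2).2
  have hderiv : ∀ x ∈ uIcc (0 : ℝ) s,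
      HasDerivAt (fun s : ℝ => -2 * Real.sqrt (1 - s) * (3 - Real.log (1 - s)))
        ((1 - Real.log (1 - x)) / Real.sqrt (1 - x)) x := by
    intro x hx
    rw [uIcc_of_le hs.1] at hx
    exact hasDerivAt_prim (hx.2.trans_lt hs.2)
  rw [integral_eq_sub_of_hasDerivAt hderiv hcq.intervalIntegrable]
  obtain ⟨h1, h2, hwpos, -, -, -⟩ := basic hs
  have hlog : Real.log (1 - s) ≤ 0 := Real.log_nonpos h1.le h2
  simp only [sub_zero, Real.log_one, Real.sqrt_one]
  nlinarith [mul_nonneg hwpos.le (show (0 : ℝ) ≤ 3 - Real.log (1 - s) by linarith)]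

/-- **SCALAR BARRIER for the quarter law (crux stmt-1574), given the pointwise efficiency law (crux stmt-22866).**
For every `c > 0`, `ν > 0` there are real functions `Z, Pal, S, D` on `[0,1)` with every scalar clause of the registered
budget stubs (`0 < Z`, `0 ≤ Pal`, `HasDerivAt Z D`, `D = 2S − 2ν·Pal`, `|S| ≤ c·Z^{3/4}·Pal^{3/4}`), blow-up, the ENERGY
CLASS `∫₀ˢ Z ≤ E`, the palinstrophy-ratio budget `∫₀ˢ Pal/Z² ≤ E'`, the POINTWISE efficiency law (`0 < Z ∧ D ≤ εZ³`
eventually, every `ε > 0` — the conclusion of `stub_depletionGivenBudget` for this triple), and NOT the quarter law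
(`¬ ∃ K, ∀ t ∈ [0,1), Z(t) ≤ K/√(1−t)`). Witness `Z = μ²(1 − log(1−t))/√(1−t)`, `μ = (3/4 + ν)/c`. A statement about
explicit real functions; nothing about Navier–Stokes is asserted. [folklore] -/
theorem scalarBarrier_quarterLaw (c ν : ℝ) (hc : 0 < c) (hν : 0 < ν) :
    ∃ Z P S D : ℝ → ℝ,
      (∀ t ∈ Ico (0 : ℝ) 1, 0 < Z t ∧ 0 ≤ P t ∧ HasDerivAt Z (D t) t ∧ D t = 2 * S t - 2 * ν * P t ∧
          |S t| ≤ c * Z t ^ (3 / 4 : ℝ) * P t ^ (3 / 4 : ℝ)) ∧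
      (∀ N : ℝ, ∃ t₁ ∈ Ico (0 : ℝ) 1, ∀ t ∈ Ico t₁ 1, N ≤ Z t) ∧
      (∃ E : ℝ, ∀ s ∈ Ico (0 : ℝ) 1, ∫ t in (0 : ℝ)..s, Z t ≤ E) ∧
      (∃ E' : ℝ, ∀ s ∈ Ico (0 : ℝ) 1, ∫ t in (0 : ℝ)..s, P t / Z t ^ 2 ≤ E') ∧
      (∀ ε : ℝ, 0 < ε → ∃ t₁ ∈ Ico (0 : ℝ) 1, ∀ t ∈ Ico t₁ 1, 0 < Z t ∧ D t ≤ ε * Z t ^ 3) ∧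
      ¬ (∃ K : ℝ, ∀ t ∈ Ico (0 : ℝ) 1, Z t ≤ K / Real.sqrt (1 - t)) := by
  obtain ⟨μ, hμ, hμc⟩ : ∃ μ : ℝ, 0 < μ ∧ c * μ = 3 / 4 + ν :=
    ⟨(3 / 4 + ν) / c, by positivity, by field_simp⟩
  have hμ2 : 0 ≤ μ ^ 2 := sq_nonneg μ
  -- positivity and the envelope of the model at one instant
  have hpt : ∀ t ∈ Ico (0 : ℝ) 1, 0 < ((1 - Real.log (1 - t)) / Real.sqrt (1 - t)) ∧ 1 / Real.sqrt (1 - t) ≤ ((1 - Real.log (1 - t)) / Real.sqrt (1 - t)) ∧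
      0 < ((1 + (1 - Real.log (1 - t)) / 2) / Real.sqrt (1 - t) ^ 3) ∧ ((1 + (1 - Real.log (1 - t)) / 2) / Real.sqrt (1 - t) ^ 3) ≤ 3 / 2 * ((1 - Real.log (1 - t)) / Real.sqrt (1 - t)) ^ 3 := by
    intro t ht
    obtain ⟨-, -, hwpos, -, -, hℓ1⟩ := basic ht
    set ℓ : ℝ := 1 - Real.log (1 - t) with hℓ_def
    set w : ℝ := Real.sqrt (1 - t) with hw_def
    have hℓ0 : 0 < ℓ := by linarith
    have hw3 : 0 < w ^ 3 := pow_pos hwpos 3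
    refine ⟨div_pos hℓ0 hwpos, div_le_div_of_nonneg_right hℓ1 hwpos.le, by positivity, ?_⟩
    rw [div_pow, show 3 / 2 * (ℓ ^ 3 / w ^ 3) = 3 / 2 * ℓ ^ 3 / w ^ 3 by ring]
    apply div_le_div_of_nonneg_right _ hw3.le
    nlinarith [le_self_pow₀ hℓ1 (by norm_num : (3 : ℕ) ≠ 0)]
  refine ⟨fun t => μ ^ 2 * ((1 - Real.log (1 - t)) / Real.sqrt (1 - t)), fun t => μ ^ 2 * ((1 - Real.log (1 - t)) / Real.sqrt (1 - t)) ^ 3,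
    fun t => (μ ^ 2 * ((1 + (1 - Real.log (1 - t)) / 2) / Real.sqrt (1 - t) ^ 3) + 2 * ν * (μ ^ 2 * ((1 - Real.log (1 - t)) / Real.sqrt (1 - t)) ^ 3)) / 2, fun t => μ ^ 2 * ((1 + (1 - Real.log (1 - t)) / 2) / Real.sqrt (1 - t) ^ 3),
    ?_, ?_, ?_, ?_, ?_, ?_⟩
  · -- the scalar clauses of the registered stubs
    intro t ht
    have hD := (hasDerivAt_model₀ ht.2).const_mul (μ ^ 2)
    obtain ⟨hz, -, hdz, hdz'⟩ := hpt t ht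
    set x : ℝ := ((1 - Real.log (1 - t)) / Real.sqrt (1 - t)) with hx_def
    set d : ℝ := ((1 + (1 - Real.log (1 - t)) / 2) / Real.sqrt (1 - t) ^ 3) with hd_def
    have hx3 : 0 ≤ x ^ 3 := pow_nonneg hz.le 3
    refine ⟨mul_pos (pow_pos hμ 2) hz, mul_nonneg hμ2 hx3, hD, by ring, ?_⟩
    rw [mul_assoc c, rpow_budget hμ hz.le]
    have hkey : c * (μ ^ 3 * x ^ 3) = μ ^ 2 * (3 / 4 + ν) * x ^ 3 := by rw [← hμc]; ring
    have hup := mul_le_mul_of_nonneg_left hdz' hμ2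
    rw [hkey, abs_le]
    constructor <;> nlinarith [mul_nonneg hμ2 hx3, mul_nonneg hμ2 hdz.le]
  · -- blow-up
    intro N
    rcases le_or_gt N 0 with hN | hN
    · refine ⟨0, ⟨le_rfl, zero_lt_one⟩, fun t ht => hN.trans ?_⟩
      exact (mul_pos (pow_pos hμ 2) (hpt t ⟨ht.1, ht.2⟩).1).le
    have hr : 0 < (μ ^ 2 / N) ^ 2 := by positivity
    refine ⟨max 0 (1 - (μ ^ 2 / N) ^ 2), ⟨le_max_left _ _, max_lt zero_lt_one (by linarith)⟩,
      fun t ht => ?_⟩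
    have ht' : t ∈ Ico (0 : ℝ) 1 := ⟨(le_max_left _ _).trans ht.1, ht.2⟩
    obtain ⟨-, -, hwpos, -, -, -⟩ := basic ht'
    obtain ⟨-, h1w, -, -⟩ := hpt t ht'
    have hle : 1 - t ≤ (μ ^ 2 / N) ^ 2 := by linarith [(le_max_right _ _).trans ht.1]
    have hw : Real.sqrt (1 - t) ≤ μ ^ 2 / N := by
      rw [← Real.sqrt_sq (by positivity : (0 : ℝ) ≤ μ ^ 2 / N)]
      exact Real.sqrt_le_sqrt hle
    have hNw : N ≤ μ ^ 2 * (1 / Real.sqrt (1 - t)) := by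
      rw [mul_one_div, le_div_iff₀ hwpos]
      calc N * Real.sqrt (1 - t) ≤ N * (μ ^ 2 / N) := mul_le_mul_of_nonneg_left hw hN.le
        _ = μ ^ 2 := by field_simp
    exact hNw.trans (mul_le_mul_of_nonneg_left h1w hμ2)
  · -- energy class
    refine ⟨6 * μ ^ 2, fun s hs => ?_⟩
    rw [intervalIntegral.integral_const_mul]
    nlinarith [integral_model₀_le hs, sq_nonneg μ]
  · -- palinstrophy-ratio budget
    refine ⟨6 / μ ^ 2, fun s hs => ?_⟩
    have heq : EqOn (fun t : ℝ => μ ^ 2 * ((1 - Real.log (1 - t)) / Real.sqrt (1 - t)) ^ 3 / (μ ^ 2 * ((1 - Real.log (1 - t)) / Real.sqrt (1 - t))) ^ 2)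
        (fun t : ℝ => (1 / μ ^ 2) * ((1 - Real.log (1 - t)) / Real.sqrt (1 - t))) (uIcc 0 s) := by
      intro t ht
      rw [uIcc_of_le hs.1] at ht
      have hz := (hpt t ⟨ht.1, ht.2.trans_lt hs.2⟩).1
      simp only
      field_simp
    rw [integral_congr heq, intervalIntegral.integral_const_mul]
    rw [show 6 / μ ^ 2 = 1 / μ ^ 2 * 6 by ring]
    exact mul_le_mul_of_nonneg_left (integral_model₀_le hs) (by positivity)
  · -- the POINTWISE efficiency law of crux stmt-22866 holds for this triple
    intro ε hε
    set M : ℝ := 3 / (2 * μ ^ 4 * ε) + 1 with hM_def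
    have hM0 : 0 < M := by positivity
    have hMε : 3 / 2 ≤ μ ^ 4 * ε * M := by
      rw [hM_def, mul_add]
      have : μ ^ 4 * ε * (3 / (2 * μ ^ 4 * ε)) = 3 / 2 := by field_simp
      nlinarith [mul_pos (pow_pos hμ 4) hε]
    have hexp : 0 < Real.exp (-M) := Real.exp_pos _
    have hexp1 : Real.exp (-M) ≤ 1 := Real.exp_le_one_iff.2 (by linarith)
    refine ⟨1 - Real.exp (-M), ⟨by linarith, by linarith⟩, fun t ht => ?_⟩
    have ht' : t ∈ Ico (0 : ℝ) 1 := ⟨by linarith [ht.1], ht.2⟩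
    obtain ⟨h1, -, hwpos, -, -, hℓ1⟩ := basic ht'
    obtain ⟨hz, -, -, -⟩ := hpt t ht'
    have hℓM : M ≤ 1 - Real.log (1 - t) := by
      have : Real.log (1 - t) ≤ Real.log (Real.exp (-M)) :=
        Real.log_le_log h1 (by linarith [ht.1])
      rw [Real.log_exp] at this
      linarith
    refine ⟨mul_pos (pow_pos hμ 2) hz, ?_⟩
    set ℓ : ℝ := 1 - Real.log (1 - t) with hℓ_def
    set w : ℝ := Real.sqrt (1 - t) with hw_def
    have hw3 : 0 < w ^ 3 := pow_pos hwpos 3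
    have hℓ2 : 3 / 2 ≤ μ ^ 4 * ε * ℓ ^ 2 := by
      have : M ≤ ℓ ^ 2 := by nlinarith
      nlinarith [mul_pos (pow_pos hμ 4) hε]
    -- `μ²(1 + ℓ/2)/w³ ≤ ε μ⁶ ℓ³/w³` since `1 + ℓ/2 ≤ (3/2)ℓ ≤ εμ⁴ℓ³`
    rw [show ε * (μ ^ 2 * (ℓ / w)) ^ 3 = μ ^ 2 * ((ε * μ ^ 4 * ℓ ^ 3) / w ^ 3) by
      rw [mul_pow, div_pow]; ring]
    refine mul_le_mul_of_nonneg_left (div_le_div_of_nonneg_right ?_ hw3.le) hμ2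
    nlinarith [mul_nonneg (show (0:ℝ) ≤ ℓ by linarith) (sub_nonneg.2 hℓ2)]
  · -- but the quarter law fails: `Z√(1−t) = μ²ℓ → ∞`
    rintro ⟨K, hK⟩
    set M : ℝ := |K| / μ ^ 2 + 1 with hM_def
    have hM0 : 0 < M := by positivity
    have hexp : 0 < Real.exp (-M) := Real.exp_pos _
    have hexp1 : Real.exp (-M) ≤ 1 := Real.exp_le_one_iff.2 (by linarith)
    have ht' : 1 - Real.exp (-M) ∈ Ico (0 : ℝ) 1 := ⟨by linarith, by linarith⟩
    have h := hK _ ht'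
    obtain ⟨h1, -, hwpos, -, -, hℓ1⟩ := basic ht'
    simp only [sub_sub_cancel, Real.log_exp] at h
    -- `h : μ² (1 + M)/w ≤ K/w`
    rw [mul_div_assoc'] at h
    have h' := (div_le_div_iff_of_pos_right (Real.sqrt_pos.2 hexp)).1 h
    have hKM : K < μ ^ 2 * M := by
      rw [hM_def, mul_add, mul_div_cancel₀ _ (by positivity)]
      nlinarith [le_abs_self K, pow_pos hμ 2]
    nlinarith [pow_pos hμ 2]

end ScalarBarrier

end EnstrophyQuarterLaw

end Summit.NavierStokesRegularity.NavierStokesRegularity.Theorems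

end
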